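import Literature.Geometry.Lorentzian.ModelDataProofs
import Literature.Geometry.Lorentzian.DecaySymbols
import Literature.Geometry.Lorentzian.HarmonicallyFlatDecay
import Literature.Geometry.Lorentzian.StronglyAsymptoticallyFlatADMEnergy
import Literature.Geometry.Lorentzian.AsymptoticFlatnessProofs
import HarnessLib

/-!
# The time-symmetric Schwarzschild exterior data are Dafermos–Rodnianski flat with mass `M`

Support file (all results proved, no definitions, no named facts). For the time-symmetric
Schwarzschild exterior data `({‖z‖ > M/2}, (1 + M/2ρ)⁴ δ, 0)` (`Schwarzschild.timeSymmetricExteriorData`,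
`ModelData.lean`, `0 ≤ M`) on the tautological end `Schwarzschild.afEnd M hM` (`R = M/2 + 1`):

* `hCoeff_afEnd_apply`, `kCoeff_afEnd` — the chart components are `h = (1 + M/2ρ)⁴ δ` beyond
  `R` and `k = 0`;
* `isBigOSmooth_conformalFactor_pow_four_sub` — the symbol estimate
  `(1 + M/2ρ)⁴ − (1 + 2M/ρ) = (M/2ρ)² (6 + 4(M/2ρ) + (M/2ρ)²) = O₂(ρ⁻²)` (symbol calculus of
  `DecaySymbols.lean`);
* **`isStronglyAsymptoticallyFlatDR_timeSymmetricExteriorData`** — `h − (1 + 2M/ρ)δ = o₂(ρ⁻¹)`,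
  `k = o₁(ρ⁻²)`: the data are strongly asymptotically flat in the sense of Dafermos–Rodnianski
  with mass `M` (`AFEnd.IsStronglyAsymptoticallyFlatDR`), the admissibility rate of the final-state
  summit — in contrast with the Kerr–Schild slices (`Kerr.not_isStronglyAsymptoticallyFlatDR_data`);
* discharges of two named facts of `ModelData.lean`:
  **`isAsymptoticallyFlat_timeSymmetricExteriorData_holds`** (asymptotic flatness of order `1`,
  via `AFEnd.IsStronglyAsymptoticallyFlatDR.IsAsymptoticallyFlat_one_holds`) and
  **`hasADMEnergy_timeSymmetricExteriorData_holds`** (ADM energy `M`, via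
  `AFEnd.IsStronglyAsymptoticallyFlatDR.hasADMEnergy`), with `admEnergy_timeSymmetricExteriorData_eq`.

References: Misner–Thorne–Wheeler 1973, (31.22); Bartnik, CPAM 39 (1986), Def. 2.1 and (4.2);
Dafermos–Rodnianski, Clay lecture notes (2013), App. B.2.3; Schoen–Yau, Comm. Math. Phys. 65 (1979),
§2 (the mass of `φ⁴ ds²`).
-/

noncomputable section

-- instance search through `E3 →L[ℝ] E3 →L[ℝ] ℝ` (as in `KerrDataAsymptoticFlatness.lean`)
set_option maxSynthPendingDepth 3
set_option synthInstance.maxHeartbeats 200000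

open Bundle TopologicalSpace Manifold Set Module Filter Asymptotics Bornology
open scoped ContDiff Topology InnerProductSpace

namespace Literature.Geometry.Lorentzian

namespace Schwarzschild

variable {M : ℝ}

/-! ### The chart components of the exterior data -/

/-- **The chart components of the metric of the time-symmetric Schwarzschild exterior data are
`(1 + M/2ρ)⁴ δ`** beyond the inner radius `M/2 + 1` of `Schwarzschild.afEnd` (an inclusion end:
the chart is the identity in ambient coordinates). MTW 1973, (31.22); Bartnik 1986, Def. 2.1.
[cite: MTW1973, (31.22)] -/
theorem hCoeff_afEnd_apply (hM : 0 ≤ M) {x : E3} (hx : M / 2 + 1 < ‖x‖) (v w : E3) :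
    AFEnd.hCoeff (afEnd M hM) (timeSymmetricExteriorData M hM) x v w =
      conformalFactor M x ^ 4 * ⟪v, w⟫_ℝ := by
  have h := hCoeff_inclusionAFEnd_apply (isotropicExterior M) (M / 2 + 1) (by linarith)
    (fun x hx ↦ by simp only [mem_isotropicExterior]; linarith) (timeSymmetricExteriorData M hM)
    hx v w
  exact h

/-- The chart components of the metric as a bilinear form: `hCoeff = (1 + M/2ρ)⁴ • δ` beyond
`M/2 + 1`. [cite: MTW1973, (31.22)] -/
theorem hCoeff_afEnd_eq (hM : 0 ≤ M) {x : E3} (hx : M / 2 + 1 < ‖x‖) :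
    AFEnd.hCoeff (afEnd M hM) (timeSymmetricExteriorData M hM) x =
      conformalFactor M x ^ 4 • (innerSL ℝ : E3 →L[ℝ] E3 →L[ℝ] ℝ) := by
  ext v w
  rw [hCoeff_afEnd_apply hM hx]
  rfl

/-- **The chart components of `k = 0` vanish** everywhere (beyond the inner radius they are the
pullback of `0`, inside it the junk value `0`). Bartnik–Isenberg 2004, §2 (time-symmetric data).
[cite: Bray2001, §1] -/
theorem kCoeff_afEnd (hM : 0 ≤ M) (x : E3) :
    AFEnd.kCoeff (afEnd M hM) (timeSymmetricExteriorData M hM) x = 0 := by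
  unfold AFEnd.kCoeff
  split_ifs
  · ext v w
    rw [pullbackBilin_apply]
    rfl
  · rfl

/-! ### The symbol estimate `(1 + M/2ρ)⁴ − (1 + 2M/ρ) = O₂(ρ⁻²)` -/

/-- **`(1 + M/2ρ)⁴ − (1 + 2M/ρ) = O₂(ρ⁻²)`** as a smooth symbol on `E3`: with `t = M/2ρ = O₂(ρ⁻¹)`,
`(1 + t)⁴ − 1 − 4t = t²(6 + 4t + t²)`. Schoen–Yau 1979, §1, (1.1) (`h = (1 + M/2r)⁴δ + O(r⁻²)`);
Bartnik 1986, (4.2). [cite: SchoenYauPMT1979, §1 (1.1)] -/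
theorem isBigOSmooth_conformalFactor_pow_four_sub (M : ℝ) :
    IsBigOSmooth 2 (-2) fun y : E3 ↦ conformalFactor M y ^ 4 - (1 + 2 * M / ‖y‖) := by
  have ht : IsBigOSmooth 2 (-1) fun y : E3 ↦ M / (2 * ‖y‖) :=
    ((isBigOSmooth_inv_norm (E := E3)).const_mul (M / 2)).congr fun y ↦ by ring
  have ht0 : IsBigOSmooth 2 0 fun y : E3 ↦ M / (2 * ‖y‖) := ht.mono (by norm_num)
  have hP : IsBigOSmooth 2 0 fun y : E3 ↦ 6 + 4 * (M / (2 * ‖y‖)) + (M / (2 * ‖y‖)) ^ 2 :=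
    ((isBigOSmooth_const 2 (6 : ℝ)).add (ht0.const_mul 4)).add (ht0.pow 2)
  have h := (ht.mul ht).mul hP
  norm_num at h
  refine h.congr fun y ↦ ?_
  rw [conformalFactor]
  ring

/-! ### Dafermos–Rodnianski flatness, asymptotic flatness of order one, ADM energy -/

/-- **The time-symmetric Schwarzschild exterior data are strongly asymptotically flat in the sense
of Dafermos–Rodnianski, with mass `M`**: in the tautological chart
`h − (1 + 2M/ρ)δ = ((1 + M/2ρ)⁴ − 1 − 2M/ρ) δ = O₂(ρ⁻²) = o₂(ρ⁻¹)` and `k = 0 = o₁(ρ⁻²)`.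
Dafermos–Rodnianski 2013, App. B.2.3 (the admissible class); Bartnik 1986, Def. 2.1, (4.2);
MTW 1973, (31.22). [cite: DafermosRodnianski2013, App. B.2.3] -/
theorem isStronglyAsymptoticallyFlatDR_timeSymmetricExteriorData (hM : 0 ≤ M) :
    (afEnd M hM).IsStronglyAsymptoticallyFlatDR (timeSymmetricExteriorData M hM) M := by
  refine ⟨fun m hm ↦ ?_, fun m hm ↦ ?_⟩
  · -- the metric part: `O₂(ρ⁻²)` beyond `M/2 + 1`, hence `o₂(ρ⁻¹)`
    have hs : IsBigOSmooth 2 (-2) fun y : E3 ↦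
        AFEnd.hCoeff (afEnd M hM) (timeSymmetricExteriorData M hM) y -
          (1 + 2 * M / ‖y‖) • (innerSL ℝ : E3 →L[ℝ] E3 →L[ℝ] ℝ) := by
      refine ((isBigOSmooth_conformalFactor_pow_four_sub M).smul_const
        (innerSL ℝ : E3 →L[ℝ] E3 →L[ℝ] ℝ)).congr_far (R₁ := M / 2 + 1) fun y hy ↦ ?_
      rw [hCoeff_afEnd_eq hM hy, sub_smul]
    exact (hs.isBigO hm).trans_isLittleO
      (isLittleO_norm_rpow_rpow_cobounded (E := E3) (by linarith))
  · -- the `k` part: identically zero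
    exact isLittleO_norm_iteratedFDeriv_of_forall_eq_zero (kCoeff_afEnd hM) m _ _

/-- **Discharge of the named fact `Schwarzschild.isAsymptoticallyFlat_timeSymmetricExteriorData`**
(`ModelData.lean`): the time-symmetric Schwarzschild exterior data are asymptotically flat of order
`1` (`h − δ = O₂(ρ⁻¹)`, `k = O₁(ρ⁻²)`), from the Dafermos–Rodnianski rates
(`AFEnd.IsStronglyAsymptoticallyFlatDR.IsAsymptoticallyFlat_one_holds`). Bartnik 1986, Def. 2.1;
Bray 2001, §1. [cite: Bartnik1986, Def. 2.1] -/
theorem isAsymptoticallyFlat_timeSymmetricExteriorData_holds (M : ℝ) :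
    isAsymptoticallyFlat_timeSymmetricExteriorData M := fun hM ↦
  AFEnd.IsStronglyAsymptoticallyFlatDR.IsAsymptoticallyFlat_one_holds (afEnd M hM)
    (timeSymmetricExteriorData M hM) (isStronglyAsymptoticallyFlatDR_timeSymmetricExteriorData hM)

/-- **Discharge of the named fact `Schwarzschild.hasADMEnergy_timeSymmetricExteriorData`**
(`ModelData.lean`): the time-symmetric Schwarzschild exterior data have ADM energy `M`
(`AFEnd.IsStronglyAsymptoticallyFlatDR.hasADMEnergy`: `h = (1 + 2M/ρ)δ + o₂(ρ⁻¹)` has energy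
fluxes converging to `M`). Arnowitt–Deser–Misner 1962; Bartnik 1986, (4.2).
[cite: Bartnik1986, §4, (4.2)] -/
theorem hasADMEnergy_timeSymmetricExteriorData_holds (M : ℝ) :
    hasADMEnergy_timeSymmetricExteriorData M := fun hM ↦
  (isStronglyAsymptoticallyFlatDR_timeSymmetricExteriorData hM).hasADMEnergy

/-- **The ADM energy of the time-symmetric Schwarzschild exterior data is `M`** (unconditional
form of `Schwarzschild.admEnergy_timeSymmetricExteriorData`). Bartnik 1986, (4.2).
[cite: Bartnik1986, §4, (4.2)] -/
theorem admEnergy_timeSymmetricExteriorData_eq (M : ℝ) (hM : 0 ≤ M) :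
    (afEnd M hM).admEnergy (timeSymmetricExteriorData M hM) = M :=
  admEnergy_timeSymmetricExteriorData M hM (hasADMEnergy_timeSymmetricExteriorData_holds M)

end Schwarzschild

end Literature.Geometry.Lorentzian

end
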